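import Summits.CriticalPhenomena.Ising3DConformalLimit.Theorems.EnergyNotSigmaSquaredMoebiusLimitExistsPedigreeStep
import Summits.CriticalPhenomena.Ising3DConformalLimit.Theorems.EnergyNotSigmaSquaredMoebiusLimitExistsPinnedZoomCompactnessOfStep
import Summits.CriticalPhenomena.Ising3DConformalLimit.Theorems.EnergyNotSigmaSquaredMoebiusLimitExistsClusterMoveIneq
import Summits.CriticalPhenomena.Ising3DConformalLimit.Theorems.EnergyNotSigmaSquaredMoebiusLimitExistsUniformRegularity
import Summits.CriticalPhenomena.Ising3DConformalLimit.Theorems.EnergyNotSigmaSquaredMoebiusLimitExistsResidueDictionary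
import Summits.CriticalPhenomena.Ising3DConformalLimit.Theorems.EnergyNotSigmaSquaredMoebiusLimitExistsReductionCpt
import Summits.CriticalPhenomena.Ising3DConformalLimit.Theorems.EnergyNotSigmaSquaredMoebiusLimitExistsPinnedTwoPoint
import Summits.CriticalPhenomena.Ising3DConformalLimit.Theses.IsingEuclidUpgrade
import Summits.CriticalPhenomena.Ising3DConformalLimit.Theses.MonotoneRG
import Summits.CriticalPhenomena.Ising3DConformalLimit.Theses.MirrorHoelderCompactness
import Summits.CriticalPhenomena.Ising3DConformalLimit.Theses.HyperoctahedralRP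
import Summits.CriticalPhenomena.Ising3DConformalLimit.Theses.PerfectScreening
import HarnessLib

/-!
# Two-point-law glue for the line `only-interaction-breaks-moebius`: STUB 1 (compactness) and the reduction to the
residues, HYPOTHESIS-FREE under item 0634
(crux `MoebiusLimitExists`, item stmt-CriticalPhenomena-1344; lead c4, 2026-08-16; `--supports stmt-CriticalPhenomena-1344`,
registered anchor `pinnedZoom_compactness_of_twoPointLaw`)

Every theorem of this file is a ONE-LINE specialisation of landed, parametrised tree theorems, made possible once the farm
built their modules: the recursion step `pedigreeStep` (…PedigreeStep.lean, p105519) fed with the cluster move inequality in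
the nine cubic site mirrors `clusterMoveIneq_cubic` (…ClusterMoveIneq.lean) discharges the `hstep` parameter of
`pinnedZoom_compactness_of_step` (…PinnedZoomCompactnessOfStep.lean, p110582); the resulting sequential compactness of the
pinned critical zoom with REGULAR cluster points (STUB 1 of the line) then discharges the `hcpt` parameter of the residue
dictionary (…ResidueDictionary.lean, p110616) and of the reduction (…ReductionCpt.lean, p110722). Results, all under the data
of item 0634 `IsingEuclidUpgradeR2RotInvPowerLaw` (`⟨σ₀σ_y⟩_{β_c}‖y‖^{2Δ} → c > 0`) and nothing else:

* `pinnedZoom_compactness_of_twoPointLaw` (anchor) — every mesh sequence has a subsequence along which the pinned rescaled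
  critical correlators converge, for all `n` at once, locally uniformly off the diagonals, to a normalised, continuous,
  translation-invariant family;
* `pinnedZoom_equicontinuity_of_twoPointLaw` — asymptotic equicontinuity of the pinned zoom at all orders;
* `uniformRegularity_of_twoPointLaw : 0634 → MirrorHoelderCompactness.UniformRegularity` (item stmt-4658) and
  `orbitPrecompact_of_twoPointLaw : 0634 → MonotoneRG.OrbitPrecompact` (item stmt-5955) — two crux items of other routes
  are COROLLARIES of item 0634;
* `existsScaleCovariantLimit_iff_residue6_of_twoPointLaw` — under 0634, item stmt-1981 `ExistsScaleCovariantLimit` is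
  EQUIVALENT to the line's registered residue 6′ `stub_interactingUnique_ge_four` (body);
* `MoebiusLimitExists_of_residues_of_twoPointLaw` / `moebiusLimitExists_iff_residues_of_twoPointLaw` — under 0634 the crux is
  EQUIVALENT to the conjunction of its two residues 5′ ∧ 6′; `interacting_clusterPoint_of_not_crux_of_twoPointLaw` — if the
  crux fails, an interacting regular subsequential scaling limit of the critical 3D Ising correlators exists.

References: H. Duminil-Copin, ICM 2022 §8.4 p. 29; M. Aizenman, H. Duminil-Copin, Ann. Math. 194 (2021), arXiv:1912.07973
Prop. 5.3 (reflection positivity in site mirrors). No definitions, no `sorry`. [folklore]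
-/

noncomputable section

open Filter Topology Set Function Metric
open Literature.Probability.LatticeModels

namespace Summit.CriticalPhenomena.Ising3DConformalLimit.MoebiusLimitExistsOnlyInteraction

/-- **STUB 1 of the line, hypothesis-free under the two-point law (registered anchor)**: sequential compactness of the
pinned critical zoom with REGULAR cluster points — `pinnedZoom_compactness_of_step` fed with the landed recursion step
`pedigreeStep clusterMoveIneq_cubic` (mirror pedigrees: cluster RP–Cauchy–Schwarz move inequality in the nine cubic site
mirrors + the covering theorem). [cite: AizenmanDuminilCopinAnnals2021, arXiv:1912.07973 Prop. 5.3] -/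
theorem pinnedZoom_compactness_of_twoPointLaw : ∀ (Δ c : ℝ), 0 < c → Tendsto (fun y : Site 3 => criticalTwoPoint 3 y * Real.sqrt (∑ i, ((y i : ℝ)) ^ 2) ^ (2 * Δ)) cofinite (𝓝 c) → ∀ u : ℕ → ℝ, Tendsto u atTop (𝓝[>] (0 : ℝ)) → ∃ (φ : ℕ → ℕ) (S : CorrFamily 3), StrictMono φ ∧ IsRegular S ∧ ∀ n, TendstoLocallyUniformlyOn (fun k => rescaledCorrelator (criticalCorr 3) rhoPin n (u (φ k))) (S n) atTop (NonCoincident 3 n) :=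
  pinnedZoom_compactness_of_step (pedigreeStep clusterMoveIneq_cubic)

/-- **Asymptotic equicontinuity of the pinned zoom at ALL orders, hypothesis-free under the two-point law**
(`pinnedZoom_equicontinuity_of_step` fed with `pedigreeStep clusterMoveIneq_cubic`). [folklore] -/
theorem pinnedZoom_equicontinuity_of_twoPointLaw :
    ∀ (Δ c : ℝ), 0 < c →
      Tendsto (fun y : Site 3 => criticalTwoPoint 3 y * Real.sqrt (∑ i, ((y i : ℝ)) ^ 2) ^ (2 * Δ))
        cofinite (𝓝 c) →
      ∀ u : ℕ → ℝ, Tendsto u atTop (𝓝[>] (0 : ℝ)) →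
        ∀ n (K : Set (Fin n → EuclideanSpace ℝ (Fin 3))), IsCompact K → K ⊆ NonCoincident 3 n →
          ∀ ε > 0, ∃ η > 0, ∀ᶠ k in atTop, ∀ x ∈ K, ∀ y ∈ K, dist x y < η →
            |rescaledCorrelator (criticalCorr 3) rhoPin n (u k) x -
              rescaledCorrelator (criticalCorr 3) rhoPin n (u k) y| < ε :=
  pinnedZoom_equicontinuity_of_step (pedigreeStep clusterMoveIneq_cubic)

/-- **Item stmt-4658 `MirrorHoelderCompactness.UniformRegularity` is a COROLLARY of item 0634** (uniform bound, uniform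
equicontinuity and uniform two-point lower bound of the pinned critical zoom on compacts off the diagonals).
[cite: DuminilCopinICM2022, §8.4 p. 29] -/
theorem uniformRegularity_of_twoPointLaw
    (h2pt : Summit.CriticalPhenomena.Ising3DConformalLimit.Theses.IsingEuclidUpgrade.IsingEuclidUpgradeR2RotInvPowerLaw) :
    Summit.CriticalPhenomena.Ising3DConformalLimit.Theses.MirrorHoelderCompactness.UniformRegularity := by
  obtain ⟨Δ, c, hc, hG⟩ := h2pt
  exact uniformRegularity_of_seqEquicont Δ c hc hG (pinnedZoom_equicontinuity_of_twoPointLaw Δ c hc hG)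

/-- **Item stmt-5955 `MonotoneRG.OrbitPrecompact` is a COROLLARY of item 0634** (sequential compactness with `ρ = ρ_pin`;
every cluster point has the pure-power, hence non-degenerate, pair function). [cite: DuminilCopinICM2022, §8.4 p. 29] -/
theorem orbitPrecompact_of_twoPointLaw
    (h2pt : Summit.CriticalPhenomena.Ising3DConformalLimit.Theses.IsingEuclidUpgrade.IsingEuclidUpgradeR2RotInvPowerLaw) :
    Summit.CriticalPhenomena.Ising3DConformalLimit.Theses.MonotoneRG.OrbitPrecompact := by
  obtain ⟨Δ, c, hc, hG⟩ := h2pt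
  exact orbitPrecompact_of_seqCompact (pinnedZoom_compactness_of_twoPointLaw Δ c hc hG)
    fun S hS => isNondegenerateTwoPoint_of_twoPoint (stub_pinnedTwoPoint Δ c hc hG S hS)

/-- **Under the two-point law, item stmt-1981 `ExistsScaleCovariantLimit` ⟺ the residue 6′** (uniqueness anchored at an
interacting regular cluster point, at even orders `≥ 4`; body of the registered `stub_interactingUnique_ge_four`).
[cite: DuminilCopinICM2022, §8.4 p. 29] -/
theorem existsScaleCovariantLimit_iff_residue6_of_twoPointLaw {Δ c : ℝ} (hc : 0 < c)
    (hG : Tendsto (fun y : Site 3 => criticalTwoPoint 3 y * Real.sqrt (∑ i, ((y i : ℝ)) ^ 2) ^ (2 * Δ))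
      cofinite (𝓝 c)) :
    Summit.CriticalPhenomena.Ising3DConformalLimit.Theses.HyperoctahedralRP.ExistsScaleCovariantLimit ↔
      ∀ (Δ' : ℝ) (S₁ S₂ : CorrFamily 3), IsClusterPoint S₁ → IsClusterPoint S₂ → IsRegular S₁ → IsRegular S₂ →
        (∀ x ∈ NonCoincident 3 2, S₁ 2 x = ‖x 0 - x 1‖ ^ (-(2 * Δ'))) →
        (∀ x ∈ NonCoincident 3 2, S₂ 2 x = ‖x 0 - x 1‖ ^ (-(2 * Δ'))) →
          HasNontrivialU4 S₁ → ∀ m : ℕ, 2 ≤ m → (NonCoincident 3 (2 * m)).EqOn (S₁ (2 * m)) (S₂ (2 * m)) :=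
  existsScaleCovariantLimit_iff_residue6_cpt Δ c hc hG (pinnedZoom_compactness_of_twoPointLaw Δ c hc hG)

/-- **THE REDUCTION, hypothesis-free**: item 0634 + the two residues 5′ (inversion identity of interacting regular cluster
points at even orders `≥ 4`) and 6′ ⇒ `MoebiusLimitExists` (the registered `MoebiusLimitExists_of_residues` of the
skeleton, as a tree theorem: `MoebiusLimitExists_of_residues_cpt` + `pinnedZoom_compactness_of_twoPointLaw`).
[cite: DuminilCopinICM2022, §8.1 eq. (8.1)–(8.2) and §8.4 p. 29] -/
theorem MoebiusLimitExists_of_residues_of_twoPointLaw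
    (h2pt : Summit.CriticalPhenomena.Ising3DConformalLimit.Theses.IsingEuclidUpgrade.IsingEuclidUpgradeR2RotInvPowerLaw)
    (h5 : ∀ (Δ : ℝ) (S : CorrFamily 3), IsClusterPoint S → IsRegular S →
      (∀ x ∈ NonCoincident 3 2, S 2 x = ‖x 0 - x 1‖ ^ (-(2 * Δ))) →
      HasNontrivialU4 S →
      ∀ m : ℕ, 2 ≤ m → ∀ x : Fin (2 * m) → EuclideanSpace ℝ (Fin 3), x ∈ NonCoincident 3 (2 * m) →
        (∀ i, x i ≠ 0) →
        S (2 * m) (fun i => EuclideanGeometry.inversion 0 1 (x i)) =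
          (∏ i, ‖x i‖ ^ (2 * Δ)) * S (2 * m) x)
    (h6 : ∀ (Δ : ℝ) (S₁ S₂ : CorrFamily 3), IsClusterPoint S₁ → IsClusterPoint S₂ →
      IsRegular S₁ → IsRegular S₂ →
      (∀ x ∈ NonCoincident 3 2, S₁ 2 x = ‖x 0 - x 1‖ ^ (-(2 * Δ))) →
      (∀ x ∈ NonCoincident 3 2, S₂ 2 x = ‖x 0 - x 1‖ ^ (-(2 * Δ))) →
      HasNontrivialU4 S₁ → ∀ m : ℕ, 2 ≤ m → (NonCoincident 3 (2 * m)).EqOn (S₁ (2 * m)) (S₂ (2 * m))) :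
    Summit.CriticalPhenomena.Ising3DConformalLimit.Theses.PerfectScreening.MoebiusLimitExists := by
  obtain ⟨Δ, c, hc, hG⟩ := h2pt
  exact MoebiusLimitExists_of_residues_cpt Δ c hc hG (pinnedZoom_compactness_of_twoPointLaw Δ c hc hG) h5 h6

/-- **Under the two-point law the crux is EQUIVALENT to the conjunction of its two residues 5′ ∧ 6′** (the converse
directions are the refuter's `ResiduesTight` / `PinnedClusterPoints`). [cite: DuminilCopinICM2022, §8.4 p. 29] -/
theorem moebiusLimitExists_iff_residues_of_twoPointLaw {Δ c : ℝ} (hc : 0 < c)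
    (hG : Tendsto (fun y : Site 3 => criticalTwoPoint 3 y * Real.sqrt (∑ i, ((y i : ℝ)) ^ 2) ^ (2 * Δ))
      cofinite (𝓝 c)) :
    Summit.CriticalPhenomena.Ising3DConformalLimit.Theses.PerfectScreening.MoebiusLimitExists ↔
      ((∀ (Δ' : ℝ) (S : CorrFamily 3), IsClusterPoint S → IsRegular S → (∀ x ∈ NonCoincident 3 2, S 2 x = ‖x 0 - x 1‖ ^ (-(2 * Δ'))) → HasNontrivialU4 S → ∀ m : ℕ, 2 ≤ m → ∀ x : Fin (2 * m) → EuclideanSpace ℝ (Fin 3), x ∈ NonCoincident 3 (2 * m) → (∀ i, x i ≠ 0) → S (2 * m) (fun i => EuclideanGeometry.inversion 0 1 (x i)) = (∏ i, ‖x i‖ ^ (2 * Δ')) * S (2 * m) x) ∧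
        (∀ (Δ' : ℝ) (S₁ S₂ : CorrFamily 3), IsClusterPoint S₁ → IsClusterPoint S₂ → IsRegular S₁ → IsRegular S₂ → (∀ x ∈ NonCoincident 3 2, S₁ 2 x = ‖x 0 - x 1‖ ^ (-(2 * Δ'))) → (∀ x ∈ NonCoincident 3 2, S₂ 2 x = ‖x 0 - x 1‖ ^ (-(2 * Δ'))) → HasNontrivialU4 S₁ → ∀ m : ℕ, 2 ≤ m → (NonCoincident 3 (2 * m)).EqOn (S₁ (2 * m)) (S₂ (2 * m)))) :=
  moebiusLimitExists_iff_residues_cpt hc hG (pinnedZoom_compactness_of_twoPointLaw Δ c hc hG)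

/-- **Card C3 hypothesis-free: failure of the crux certifies interaction.** Given item 0634, if `MoebiusLimitExists` fails
then some regular cluster point of the pinned critical zoom has a non-trivial connected four-point function.
[cite: AizenmanCDM2020, Prop. 7.2 and remark p. 23] -/
theorem interacting_clusterPoint_of_not_crux_of_twoPointLaw
    (h2pt : Summit.CriticalPhenomena.Ising3DConformalLimit.Theses.IsingEuclidUpgrade.IsingEuclidUpgradeR2RotInvPowerLaw)
    (hnot : ¬ Summit.CriticalPhenomena.Ising3DConformalLimit.Theses.PerfectScreening.MoebiusLimitExists) :
    ∃ S : CorrFamily 3, IsClusterPoint S ∧ IsRegular S ∧ HasNontrivialU4 S := by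
  obtain ⟨Δ, c, hc, hG⟩ := h2pt
  exact interacting_clusterPoint_of_not_crux_cpt hc hG (pinnedZoom_compactness_of_twoPointLaw Δ c hc hG) hnot

end Summit.CriticalPhenomena.Ising3DConformalLimit.MoebiusLimitExistsOnlyInteraction

end
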